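/-
Copyright: the b2b-balaban cell (near-miss cell 7), T⁴-continuum fan-out, lineage t4-ne7b-p3 (node U5c LARGE-DEVIATION
member P3).  Released under the licence of the surrounding project.
-/
import Summits.QuantumFields.BalabanUV.T4Continuum.Support.SpaceTimeOccTorus
import Summits.QuantumFields.BalabanUV.T4Continuum.Support.SpaceTimeAssembly

/-!
# Space-time Peierls ∕ Cramér route for NE7b — THE LINEAGE READINGS ON THE TORUS FROM REALISED LINEAGES:
# `LineageReadings` INSTANTIATED with `cover`, the entropy fields and the cell clause PROVED

Summits-side support leaf of the T⁴-continuum cell (rung (B)+1 on a FINITE torus only; NOT infinite volume, NOT the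
mass gap, NOT the Clay statement; NOT a proof of the spine estimate NE7b).  Lineage `t4-ne7b-p3` (generation 2), node
U5c, skeleton `t4/skeletons/NE7b-t4-ne7b-p3.md` §11.  [folklore] assembly over `SpaceTimeOccTorus` (`LinData`,
`contourCover`, `card_contour_le_tree`), `SpaceTimeCellsVar` (`degree_stGraphV_le`, `card_anchorsV_le`),
`SpaceTimeAnimals.siteAnimalBound_sq` and `SpaceTimeAssembly.LineageReadings`; nothing printed is asserted; no
`[cite:]` tag.

WHAT.  **`LinData.lineageReadings`**: for the lineage data `D` of one run realised in the index model over the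
cutoff torus (events `PEv`, steps `PEv.step`, typed ratios `ratio L σ` under the drop control, levels `ℓ` monotone with
jumps `≤ 2` and `q u = L^{ℓ(u+1) − ℓ u}`), the structure `LineageReadings D.model C K Kc R g A Bad jlo nup Δ Δ₁ Nanc
(8·126^d) (126^d) dC c₃` HOLDS with `Δ = 3^d + L^{2d} + 1`, `Δ₁ = (Δ+1)²`, `Nanc = (n·L^{Kx − ℓ K})^d`, PROVIDED the
displayed readings: nonnegative weights; every bad term has a lineage with an event of step `≤ jlo` and nonempty piece
(the old structure); SEPARATION of distinct lineages of a term; per lineage `Consistent ∧ WF ∧ K + 1 ≤ reach ∧ SkelOK`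
(the COUNT carrier: `SpaceTimeJunction.skelOK_of_realises`); the FACTORISATION of the raw banked factor of the
lineage containing the contour; the REMAINDER bound.  The fields `deg`, `animal`, `anchors`, `cover` and the cell
clause of `lineage` are PROVED here; what is displayed is exactly the hypothesis list of the theorem.

HONEST DEPENDENCY (cell, verbatim): continuum YM on T⁴ ⇐ BetaPertH ∧ nine spine estimates (0/9 proved); BetaPertH ⇐
(D1) ∧ (D4) ∧ CAP+tail; G-an2-4 gates asym, D1 and NE2/3/4.  This file changes none of it.
-/

open Finset

namespace Summit.QuantumFields.BalabanUV.T4Continuum.SpaceTimePeierls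

open Literature.MathematicalPhysics.QuantumFieldTheory.Balaban1983to89
open Literature.MathematicalPhysics.QuantumFieldTheory.Balaban1983to89.B13ScaleTransfer
open Literature.MathematicalPhysics.QuantumFieldTheory.Balaban1983to89.B16SProfile
open T4PersistenceDictionary T4BankedInduction T4PrintedShapeBanking
open Summit.QuantumFields.BalabanUV.T4Continuum.ZoneTorus
open SpaceTimePeierlsLeaves

noncomputable section

open Classical

namespace LinData

variable {d n L Kx K : ℕ} {ℓ : ℕ → ℕ} {ι Λ : Type*} (D : LinData d n L Kx K ℓ ι Λ PEv)

/-- **THE LINEAGE READINGS ON THE TORUS FROM REALISED LINEAGES.**  See the module docstring: the entropy fields, the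
contour cover and the cell clause are proved; nonnegativity, the old structure of bad terms, separation, the
per-lineage consistency ∕ well-formedness ∕ reach ∕ `SkelOK`, the factorisation and the remainder bound are the
hypotheses (readings of Bałaban's expansion). [folklore] -/
theorem lineageReadings {C : T4PrintedShapeBanking.Consts} {Kc : ℕ} {R : ℕ → ℕ} {g : ℕ → ℝ} {A : ι → ℝ}
    {Bad : Finset ι} {jlo : ℕ} {nup dC c₃ : ℝ} {σ : ℕ → ℕ} {m : ℕ}
    {rest : Finset (STCellV d n L Kx K ℓ) → ι → ℝ}
    (hn : 0 < n) (hL : 4 ≤ L) (hmono : ∀ u, ℓ u ≤ ℓ (u + 1)) (hjump : ∀ u, ℓ (u + 1) ≤ ℓ u + 2)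
    (hq : D.q = ratio L σ) (hqℓ : ∀ u, D.q u = L ^ (ℓ (u + 1) - ℓ u)) (hdrop : DropCtl σ m) (hK : K ≤ m)
    (hdC : 0 ≤ dC) (hstep : D.step = PEv.step)
    (hnonneg : ∀ τ ∈ D.T, 0 ≤ A τ) (hBad : Bad ⊆ D.T) (hjlo : jlo ≤ K)
    (hold : ∀ τ ∈ Bad, ∃ lam ∈ D.fam τ, ∃ b ∈ (D.G lam).events, D.step b ≤ jlo ∧ (D.piece b).Nonempty)
    (hsep : D.Separated)
    (hlin : ∀ τ ∈ D.T, ∀ lam ∈ D.fam τ, Consistent C Kc R (D.G lam) ∧ (D.G lam).WF (dictW R C.n₁) ∧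
      K + 1 ≤ (D.G lam).reach (dictW R C.n₁) ∧ SkelOK D.q D.step D.piece PEv.fat dC (D.G lam))
    (hfac : ∀ (𝒦 : Finset (STCellV d n L Kx K ℓ)), ∀ τ ∈ D.T, D.model.IsContour τ 𝒦 → ∀ lam ∈ D.fam τ,
      (∀ c ∈ 𝒦, D.InLin lam c) →
        A τ ≤ Real.exp (-(credits (credit C g) (D.G lam) - lifeCost (dictW R C.n₁) (cost C Kc R) (D.G lam))) *
          rest 𝒦 τ)
    (hrest0 : ∀ (𝒦 : Finset (STCellV d n L Kx K ℓ)), ∀ τ ∈ D.T, 0 ≤ rest 𝒦 τ)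
    (hrest : ∀ (𝒦 : Finset (STCellV d n L Kx K ℓ)),
      ∑ τ ∈ D.model.T.filter (fun τ => D.model.IsContour τ 𝒦), rest 𝒦 τ ≤ Real.exp c₃ ^ 𝒦.card * nup) :
    LineageReadings D.model C K Kc R g A Bad jlo nup (3 ^ d + L ^ (2 * d) + 1)
      ((((3 ^ d + L ^ (2 * d) + 1 : ℕ) : ℝ) + 1) ^ 2) (((n * L ^ (Kx - ℓ K)) ^ d : ℕ) : ℝ)
      (8 * 126 ^ d) (126 ^ d) dC c₃ := by
  -- the lineage containing a contour, with its cell bound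
  have key : ∀ (τ : ι) (𝒦 : Finset (STCellV d n L Kx K ℓ)), τ ∈ D.T ∧ D.model.IsContour τ 𝒦 →
      ∃ lam ∈ D.fam τ, (∀ c ∈ 𝒦, D.InLin lam c) ∧
        (𝒦.card : ℝ) ≤ 8 * 126 ^ d * treeD PEv.fat PEv.step dC (D.G lam) (K + 1) +
          126 ^ d * treeSteps PEv.step (D.G lam) (K + 1) := by
    intro τ 𝒦 h
    have hct := D.card_contour_le_tree (fat := PEv.fat) hsep h.1 h.2 hL hq hdrop hK hdC
      fun lam hlam => (hlin τ h.1 lam hlam).2.2.2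
    rw [hstep] at hct
    exact hct
  refine
    { deg := fun c => degree_stGraphV_le (by omega) hjump c
      animal := siteAnimalBound_sq (3 ^ d + L ^ (2 * d) + 1)
      anchors := ?_
      nonneg := hnonneg
      cover := D.contourCover (fat := PEv.fat) (dC := dC) hn (by omega) hmono hqℓ hBad hjlo fun τ hτ => ?_
      lineage := ?_ }
  · have h := card_anchorsV_le (d := d) (n := n) (L := L) (Kx := Kx) (K := K) (ℓ := ℓ) (by omega) (D.hℓK K le_rfl)
    exact_mod_cast h
  · obtain ⟨lam, hlam, b, hb, hbj, hne⟩ := hold τ hτ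
    exact ⟨lam, hlam, (hlin τ (hBad hτ) lam hlam).2.2.2, b, hb, hbj, hne⟩
  · refine ⟨fun τ 𝒦 => if h : τ ∈ D.T ∧ D.model.IsContour τ 𝒦 then D.G (Classical.choose (key τ 𝒦 h))
        else Gen.born default 0, rest, fun _ _ => K + 1, fun 𝒦 τ hτ h𝒦 => ?_, hrest0, hrest⟩
    have hgen : (if h : τ ∈ D.T ∧ D.model.IsContour τ 𝒦 then D.G (Classical.choose (key τ 𝒦 h))
        else Gen.born default 0) = D.G (Classical.choose (key τ 𝒦 ⟨hτ, h𝒦⟩)) := dif_pos ⟨hτ, h𝒦⟩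
    beta_reduce
    rw [hgen]
    obtain ⟨hlam, hin, hcard⟩ := Classical.choose_spec (key τ 𝒦 ⟨hτ, h𝒦⟩)
    obtain ⟨hcons, hwf, hreach, -⟩ := hlin τ hτ _ hlam
    exact ⟨hcons, hwf, hreach, hcard, hfac 𝒦 τ hτ h𝒦 _ hlam hin⟩

end LinData

end

end Summit.QuantumFields.BalabanUV.T4Continuum.SpaceTimePeierls
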